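import Summits.HubbardSuperconductivity.HubbardSuperconductivity.Theses.ThermalWedge
import Literature.MathematicalPhysics.QuantumLattice.LiebFluxPhaseProofs

/-!
# Sketch — crux-ideate round 1, ideator 1 (gen 2), crux `TwSeededEnsembleEquivalence`
  (stmt-HubbardSuperconductivity-1698)

First lemmas of the idea cards (signatures over existing declarations; `sorry` bodies are
allowed at this stage — they only have to ELABORATE):

* card `exposed-density-duality` : `HullTouch`, `crux_of_hullTouch`, `OneParticleCostT0`,
  `GroundSectorExists`, `EvenSectorRealisesMin`, `kink_lemma`, `ExposedDensityT0`,
  `crux_of_exposedDensity`.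
* card `source-as-regulator`      : `optimizer_floor`, `TZeroAHM`, `SourcedNodalRegularity`,
  `SeededOptimizerFloor`, `seededOptimizerFloor_of_nodal`, `ExposedDensityOnFloorSeeds`,
  `exposedDensity_of_nodal`, `seedMonotone_minEnergyOn`, `transfer_ineq`, `CruxOnInertPlateau`,
  `cruxOnInertPlateau_of_route_items`.
-/

set_option linter.dupNamespace false
set_option linter.unusedVariables false

noncomputable section

namespace Summit.HubbardSuperconductivity.HubbardSuperconductivity.Cruxes.TwSeededEnsembleEquivalence.Ideator1

open Matrix Filter Topology Literature.MathematicalPhysics.QuantumLattice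
open Summit.HubbardSuperconductivity.HubbardSuperconductivity.Theses.ThermalWedge
open scoped ComplexOrder

/-! ### Notation (same abbreviations as the crux's `Disproof.lean`) -/

/-- The d-wave seed `P = Δ_dᴴ Δ_d`. -/
abbrev seed (L : ℕ) [NeZero L] :
    Matrix (Finset (Orb (FermionTorus 2 L))) (Finset (Orb (FermionTorus 2 L))) ℂ :=
  (pairField dWaveFormFactor L)ᴴ * pairField dWaveFormFactor L

/-- Canonical seeded Hamiltonian `H_L(U,g) = hubbardTorus 2 L 1 U − (g/L²) P`. -/
abbrev Hcan (L : ℕ) [NeZero L] (U g : ℝ) :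
    Matrix (Finset (Orb (FermionTorus 2 L))) (Finset (Orb (FermionTorus 2 L))) ℂ :=
  hubbardTorus 2 L 1 U - ((g / (L : ℝ) ^ 2 : ℝ) : ℂ) • seed L

/-- Grand-canonical seeded Hamiltonian `Hcan − μ N̂`. -/
abbrev Hgc (L : ℕ) [NeZero L] (U μ g : ℝ) :
    Matrix (Finset (Orb (FermionTorus 2 L))) (Finset (Orb (FermionTorus 2 L))) ℂ :=
  hubbardTorusWith 2 L 1 U μ - ((g / (L : ℝ) ^ 2 : ℝ) : ℂ) • seed L

/-- `N_L = 2⌊(1−δ)L²/2⌋₊`. -/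
abbrev NL (δ : ℝ) (L : ℕ) : ℕ := 2 * ⌊(1 - δ) * (L : ℝ) ^ 2 / 2⌋₊

/-- `N`-particle sector ground energy of the seeded canonical Hamiltonian (min over `S^z`). -/
abbrev eN (L : ℕ) [NeZero L] (U g : ℝ) (N : ℕ) : ℝ :=
  (Hcan L U g).minEnergyOn (nParticleSubmodule N : Submodule ℂ (Fock (Orb (FermionTorus 2 L))))

/-- Sourced torus pressure `p̃_L(β,μ,U,h)`. -/
abbrev pS (L : ℕ) [NeZero L] (β U μ h : ℝ) : ℝ :=
  Real.log (Matrix.partitionFn β (dWaveSourceTorus L U μ h)).re / (β * (L : ℝ) ^ 2)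

/-- Seeded grand-canonical pressure `p_L(β,μ,U,g)`. -/
abbrev pG (L : ℕ) [NeZero L] (β U μ g : ℝ) : ℝ :=
  Real.log (Matrix.partitionFn β (Hgc L U μ g)).re / (β * (L : ℝ) ^ 2)

/-- The crux's left-hand side `A_L(β, μ; U, g, δ)`. -/
abbrev cruxLHS (L : ℕ) [NeZero L] (δ β U μ g : ℝ) : ℝ :=
  (Hcan L U g).minEnergyOn (szSector (Λ := FermionTorus 2 L) (NL δ L) 0) / (L : ℝ) ^ 2 +
    pG L β U μ g - μ * (2 * (⌊(1 - δ) * (L : ℝ) ^ 2 / 2⌋₊ : ℝ)) / (L : ℝ) ^ 2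

/-- Read-back: the crux is `∀δ ∃μ₁μ₂ ∃U₀ ∀U ∀g ∀β ∃μ ∀ε, eventually cruxLHS ≤ log 4/β + ε`. -/
theorem crux_iff' :
    TwSeededEnsembleEquivalence ↔
      ∀ δ ∈ Set.Icc (1/10 : ℝ) (2/5 : ℝ), ∃ μ₁ μ₂ : ℝ, -4 < μ₁ ∧ μ₁ ≤ μ₂ ∧ μ₂ < 0 ∧ ∃ U₀ : ℝ, 0 < U₀ ∧
        ∀ U ∈ Set.Ioc (0 : ℝ) U₀, ∀ g ∈ Set.Ioc (0 : ℝ) (1 / 10), ∀ β : ℝ, 1 ≤ β →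
          ∃ μ ∈ Set.Icc μ₁ μ₂, ∀ ε : ℝ, 0 < ε → ∃ L₀ : ℕ, ∀ (L : ℕ) [NeZero L], L₀ ≤ L →
            cruxLHS L δ β U μ g ≤ Real.log 4 / β + ε :=
  Iff.rfl

/-! ## Card `exposed-density-duality` -/

/-- **HullTouch** (β-free form of the crux): the `(N_L, S^z = 0)`-sector ground energy touches the
supporting line of slope `μ` of the grand-canonical ground energy `E₀(Hcan − μN̂)` up to `o(L²)`,
for one `L`-independent `μ` in a `δ`-uniform window. -/
def HullTouch : Prop :=
  ∀ δ ∈ Set.Icc (1/10 : ℝ) (2/5 : ℝ), ∃ μ₁ μ₂ : ℝ, -4 < μ₁ ∧ μ₁ ≤ μ₂ ∧ μ₂ < 0 ∧ ∃ U₀ : ℝ, 0 < U₀ ∧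
    ∀ U ∈ Set.Ioc (0 : ℝ) U₀, ∀ g ∈ Set.Ioc (0 : ℝ) (1 / 10), ∃ μ ∈ Set.Icc μ₁ μ₂, ∀ ε : ℝ, 0 < ε →
      ∃ L₀ : ℕ, ∀ (L : ℕ) [NeZero L], L₀ ≤ L →
        (Hcan L U g).minEnergyOn (szSector (Λ := FermionTorus 2 L) (NL δ L) 0) - μ * (NL δ L : ℝ) ≤
          (Hgc L U μ g).groundEnergy + ε * (L : ℝ) ^ 2

/-- `HullTouch → crux` at EVERY `β > 0` by dimension counting:
`Re Z(β, Hgc) ≤ 4^{L²} e^{−β E₀(Hgc)}` (`partitionFn_le_card_mul_exp`), so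
`cruxLHS ≤ [minE − μN_L − E₀(Hgc)]/L² + log 4/β`. Provable now. -/
theorem crux_of_hullTouch : HullTouch → TwSeededEnsembleEquivalence := by
  sorry

/-- **One-particle cost at T = 0** (provable now, no entropy): removing / adding one electron
changes the `N`-sector ground energy of the seeded model by at most the one-particle band-plus-
interaction scale. Proof: average `⟨c_kψ, H c_kψ⟩` over orbitals `k` with weights `‖c_kψ‖²`
(total `N`), resp. `c_k†` (total `2L² − N`), and bound `Σ_k ‖[H, c_k]‖ ≤ 2L²(4 + U + 32 g)`
(`‖[Δ_d, c_k†]‖ ≤ 4√2`, `‖Δ_d‖ ≤ 4√2 L²`). -/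
def OneParticleCostT0 : Prop :=
  ∀ (L : ℕ) [NeZero L] (U g : ℝ), 0 ≤ U → 0 ≤ g → ∀ N : ℕ, 1 ≤ N → N + 1 ≤ 2 * L ^ 2 →
    eN L U g (N - 1) ≤ eN L U g N + 2 * (4 + U + 32 * g) * (2 * (L : ℝ) ^ 2) / N ∧
    eN L U g (N + 1) ≤ eN L U g N + 2 * (4 + U + 32 * g) * (2 * (L : ℝ) ^ 2) / (2 * (L : ℝ) ^ 2 - N)

/-- Finite-dimensional bookkeeping (provable now): `Hgc = Hcan − μN̂` is block-diagonal in `N`, so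
its ground energy is attained in some sector and is below every sector value. -/
def GroundSectorExists : Prop :=
  ∀ (L : ℕ) [NeZero L] (U μ g : ℝ),
    (∃ N : ℕ, N ≤ 2 * L ^ 2 ∧ (Hgc L U μ g).groundEnergy = eN L U g N - μ * N) ∧
    ∀ N : ℕ, N ≤ 2 * L ^ 2 → (Hgc L U μ g).groundEnergy ≤ eN L U g N - μ * N

/-- `SU(2)` bookkeeping (provable now): for even `N` the `S^z = 0` sector realises the `N`-sector
minimum (every spin multiplet meets `S^z = 0`; `Hcan` is spin-rotation invariant because the
d-wave pair is a singlet). -/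
def EvenSectorRealisesMin : Prop :=
  ∀ (L : ℕ) [NeZero L] (U g : ℝ) (N : ℕ), Even N → N ≤ 2 * L ^ 2 →
    (Hcan L U g).minEnergyOn (szSector (Λ := FermionTorus 2 L) N 0) = eN L U g N

/-- **Kink lemma** (pure real analysis, provable now): pointwise convergence near `μ₀` plus
differentiability of the limit at `μ₀` pins the one-sided secant slopes of the approximants.
With concavity of `μ ↦ E₀(Hgc_L(μ))/L²` this brackets ALL grand-canonical ground-sector densities
at `μ₀` into `[1−δ−η, 1−δ+η]` for `L ≥ L₀`. -/
theorem kink_lemma (f : ℕ → ℝ → ℝ) (e : ℝ → ℝ) (μ₀ d r : ℝ) (hr : 0 < r)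
    (hlim : ∀ μ ∈ Set.Icc (μ₀ - r) (μ₀ + r), Tendsto (fun L => f L μ) atTop (𝓝 (e μ)))
    (hd : HasDerivAt e d μ₀) :
    ∀ η : ℝ, 0 < η → ∃ τ : ℝ, 0 < τ ∧ τ ≤ r ∧ ∃ L₀ : ℕ, ∀ L, L₀ ≤ L →
      |(f L (μ₀ + τ) - f L μ₀) / τ - d| ≤ η ∧ |(f L μ₀ - f L (μ₀ - τ)) / τ - d| ≤ η := by
  intro η hη
  -- slope control from the derivative
  have hslope := hd.tendsto_slope_zero
  rw [Metric.tendsto_nhdsWithin_nhds] at hslope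
  obtain ⟨δ, hδ, hδ'⟩ := hslope (η / 2) (by linarith)
  set τ : ℝ := min (δ / 2) r with hτ
  have hτpos : 0 < τ := lt_min (by linarith) hr
  have hτr : τ ≤ r := min_le_right _ _
  have hτδ : τ < δ := lt_of_le_of_lt (min_le_left _ _) (by linarith)
  refine ⟨τ, hτpos, hτr, ?_⟩
  -- pointwise convergence at the three points
  have hmem0 : μ₀ ∈ Set.Icc (μ₀ - r) (μ₀ + r) := ⟨by linarith, by linarith⟩
  have hmemp : μ₀ + τ ∈ Set.Icc (μ₀ - r) (μ₀ + r) := ⟨by linarith, by linarith⟩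
  have hmemm : μ₀ - τ ∈ Set.Icc (μ₀ - r) (μ₀ + r) := ⟨by linarith, by linarith⟩
  have hε : 0 < η * τ / 4 := by positivity
  obtain ⟨N0, hN0⟩ := Metric.tendsto_atTop.1 (hlim μ₀ hmem0) (η * τ / 4) hε
  obtain ⟨Np, hNp⟩ := Metric.tendsto_atTop.1 (hlim (μ₀ + τ) hmemp) (η * τ / 4) hε
  obtain ⟨Nm, hNm⟩ := Metric.tendsto_atTop.1 (hlim (μ₀ - τ) hmemm) (η * τ / 4) hε
  refine ⟨max N0 (max Np Nm), fun L hL => ?_⟩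
  have hL0 : N0 ≤ L := le_trans (le_max_left _ _) hL
  have hLp : Np ≤ L := le_trans (le_trans (le_max_left _ _) (le_max_right _ _)) hL
  have hLm : Nm ≤ L := le_trans (le_trans (le_max_right _ _) (le_max_right _ _)) hL
  have e0 := hN0 L hL0
  have ep := hNp L hLp
  have em := hNm L hLm
  rw [Real.dist_eq] at e0 ep em
  -- derivative slopes at ±τ
  have sp := hδ' (x := τ) (by simp [hτpos.ne']) (by rw [dist_zero_right, Real.norm_eq_abs, abs_of_pos hτpos]; exact hτδ)
  have sm := hδ' (x := -τ) (by simp [hτpos.ne']) (by rw [dist_zero_right, Real.norm_eq_abs, abs_neg, abs_of_pos hτpos]; exact hτδ)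
  rw [Real.dist_eq] at sp sm
  simp only [smul_eq_mul] at sp sm
  have hτne : τ ≠ 0 := hτpos.ne'
  constructor
  · -- right secant
    have key : (f L (μ₀ + τ) - f L μ₀) / τ - d =
        (τ⁻¹ * (e (μ₀ + τ) - e μ₀) - d) + ((f L (μ₀ + τ) - e (μ₀ + τ)) - (f L μ₀ - e μ₀)) / τ := by
      field_simp
      ring
    rw [key]
    have h1 : |τ⁻¹ * (e (μ₀ + τ) - e μ₀) - d| ≤ η / 2 := sp.le
    have h2 : |((f L (μ₀ + τ) - e (μ₀ + τ)) - (f L μ₀ - e μ₀)) / τ| ≤ η / 2 := by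
      rw [abs_div, abs_of_pos hτpos, div_le_iff₀ hτpos]
      calc |(f L (μ₀ + τ) - e (μ₀ + τ)) - (f L μ₀ - e μ₀)|
          ≤ |f L (μ₀ + τ) - e (μ₀ + τ)| + |f L μ₀ - e μ₀| := abs_sub _ _
        _ ≤ η * τ / 4 + η * τ / 4 := add_le_add ep.le e0.le
        _ = η / 2 * τ := by ring
    calc |τ⁻¹ * (e (μ₀ + τ) - e μ₀) - d + ((f L (μ₀ + τ) - e (μ₀ + τ)) - (f L μ₀ - e μ₀)) / τ|
        ≤ |τ⁻¹ * (e (μ₀ + τ) - e μ₀) - d| + |((f L (μ₀ + τ) - e (μ₀ + τ)) - (f L μ₀ - e μ₀)) / τ| :=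
          abs_add_le _ _
      _ ≤ η / 2 + η / 2 := add_le_add h1 h2
      _ = η := by ring
  · -- left secant
    have key : (f L μ₀ - f L (μ₀ - τ)) / τ - d =
        ((-τ)⁻¹ * (e (μ₀ + -τ) - e μ₀) - d) + ((f L μ₀ - e μ₀) - (f L (μ₀ - τ) - e (μ₀ - τ))) / τ := by
      rw [← sub_eq_add_neg]
      field_simp
      ring
    rw [key]
    have h1 : |(-τ)⁻¹ * (e (μ₀ + -τ) - e μ₀) - d| ≤ η / 2 := sm.le
    have h2 : |((f L μ₀ - e μ₀) - (f L (μ₀ - τ) - e (μ₀ - τ))) / τ| ≤ η / 2 := by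
      rw [abs_div, abs_of_pos hτpos, div_le_iff₀ hτpos]
      calc |(f L μ₀ - e μ₀) - (f L (μ₀ - τ) - e (μ₀ - τ))|
          ≤ |f L μ₀ - e μ₀| + |f L (μ₀ - τ) - e (μ₀ - τ)| := abs_sub _ _
        _ ≤ η * τ / 4 + η * τ / 4 := add_le_add e0.le em.le
        _ = η / 2 * τ := by ring
    calc |(-τ)⁻¹ * (e (μ₀ + -τ) - e μ₀) - d + ((f L μ₀ - e μ₀) - (f L (μ₀ - τ) - e (μ₀ - τ))) / τ|
        ≤ |(-τ)⁻¹ * (e (μ₀ + -τ) - e μ₀) - d| + |((f L μ₀ - e μ₀) - (f L (μ₀ - τ) - e (μ₀ - τ))) / τ| :=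
          abs_add_le _ _
      _ ≤ η / 2 + η / 2 := add_le_add h1 h2
      _ = η := by ring

/-- **C⁺ of the card (Transfer).** EXPOSED DENSITY AT T = 0: the thermodynamic limit of the seeded
grand-canonical GROUND-ENERGY density `e(μ) = lim L⁻² E₀(Hcan_L − μN̂)` exists near some `μ₀` of a
`δ`-uniform window and is differentiable there with slope `−(1−δ)` — i.e. `1−δ` is an exposed
density of the seeded model (no first-order density jump across `1−δ` at T = 0). By the T = 0
approximating-Hamiltonian theorem `e(μ) = inf_h [ẽ(μ,h) + h²/g]` with `ẽ` the ground-energy density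
of the SHORT-RANGE sourced model `dWaveSourceTorus`, so this is a statement about one concave real
function built from a finite-range model (Danskin: it holds iff all AHM optimisers share one
sourced density). -/
def ExposedDensityT0 : Prop :=
  ∀ δ ∈ Set.Icc (1/10 : ℝ) (2/5 : ℝ), ∃ μ₁ μ₂ : ℝ, -4 < μ₁ ∧ μ₁ ≤ μ₂ ∧ μ₂ < 0 ∧ ∃ U₀ : ℝ, 0 < U₀ ∧
    ∀ U ∈ Set.Ioc (0 : ℝ) U₀, ∀ g ∈ Set.Ioc (0 : ℝ) (1 / 10), ∃ μ₀ ∈ Set.Icc μ₁ μ₂,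
      ∃ e : ℝ → ℝ, ∃ r : ℝ, 0 < r ∧
        (∀ μ ∈ Set.Icc (μ₀ - r) (μ₀ + r),
          Tendsto (fun L : ℕ => (Hgc (L + 1) U μ g).groundEnergy / ((L + 1 : ℕ) : ℝ) ^ 2)
            atTop (𝓝 (e μ))) ∧
        HasDerivAt e (-(1 - δ)) μ₀

/-- **The line** (composition to be kernel-checked at crux-plan): exposed density ⇒ ground sectors
at `μ₀` have density within `η` of `1−δ` (kink lemma + supergradients) ⇒ walk `≤ ηL² + 2`
one-particle steps to `N_L` (cost `C η L²`, entropy-free) ⇒ `HullTouch` ⇒ crux. -/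
theorem crux_of_exposedDensity :
    OneParticleCostT0 → GroundSectorExists → EvenSectorRealisesMin → ExposedDensityT0 →
      TwSeededEnsembleEquivalence := by
  sorry


/-! ### Finite-β member of the same closer (covers `β ≤ e^{a/U}` for ALL seeds with thermal inputs) -/

/-- Sector partition function `Z_N(β) = Tr_{H_N} e^{−β Hcan}` in the occupation basis (the
projection onto the `N`-particle sector is diagonal there). Proof-internal object (the grounder
flagged that the tree has no sector-restricted partition function; this is its one-line form). -/
abbrev ZN (L : ℕ) [NeZero L] (β U g : ℝ) (N : ℕ) : ℝ :=
  (∑ S ∈ (Finset.univ.filter fun S : Finset (Orb (FermionTorus 2 L)) => S.card = N),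
      (Matrix.gibbsWeight β (Hcan L U g)) S S).re

/-- **One-jump cost** (finite β, provable now): removing `m = N − N'` electrons AT ONCE through the
binomial Stinespring channel `ρ ↦ C(N,m)⁻¹ Σ_{|K|=m} c_K ρ c_K†` costs energy `≤ m·c₁` (iterate
`Σ_k c_k† H c_k = (N̂−1)H − V_U − V_g`, `V_U ≥ 0`, `−V_g ≤ 32 g L²`) and entropy
`≤ log C(2L², m) ≤ m log(2eL²/m)` (Kraus rank), so by the Gibbs variational principle
`log Z_{N'} ≥ log Z_N − m[β c₁ + log(2eL²/m)]`; dually for adding electrons with `c_K†`.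
The `log(1/η)`-per-particle entropy price (not `log L²`) is what lets a FIXED density window
`m = ηL²` be walked at cost `η(β c₁ + log(2e/η)) L²`. -/
def OneJumpCost : Prop :=
  ∀ (L : ℕ) [NeZero L] (β U g : ℝ), 0 < β → 0 ≤ U → 0 ≤ g → ∀ N N' : ℕ, N' < N →
    ((L : ℝ) ^ 2 / 2 ≤ N' → N ≤ 2 * L ^ 2 →
      Real.log (ZN L β U g N) -
          ((N : ℝ) - N') * (β * (4 * (4 + U + 32 * g)) + Real.log (2 * Real.exp 1 * (L : ℝ) ^ 2 / ((N : ℝ) - N'))) ≤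
        Real.log (ZN L β U g N')) ∧
    ((N : ℝ) ≤ 19 / 10 * (L : ℝ) ^ 2 →
      Real.log (ZN L β U g N') -
          ((N : ℝ) - N') * (β * (40 * (4 + U + 32 * g)) + Real.log (2 * Real.exp 1 * (L : ℝ) ^ 2 / ((N : ℝ) - N'))) ≤
        Real.log (ZN L β U g N))

/-- **C⁺, thermal member.** EXPOSED DENSITY AT INVERSE TEMPERATURE β: the limiting seeded pressure
`p(β,·,g) = lim p_L` exists near some `μ₀(β)` of the `δ`-window and is differentiable there with
`p'(μ₀) = 1 − δ`. (By AHM `p = sup_h [p̃(β,·,h) − h²/g]`; Danskin: differentiable iff all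
optimisers share one sourced density.) For `β ≤ e^{a/U}` every source `h` is inside the
Benfatto–Giuliani–Mastropietro window, so this member needs thermal technology only. -/
def ExposedDensityThermal : Prop :=
  ∀ δ ∈ Set.Icc (1/10 : ℝ) (2/5 : ℝ), ∃ μ₁ μ₂ : ℝ, -4 < μ₁ ∧ μ₁ ≤ μ₂ ∧ μ₂ < 0 ∧ ∃ U₀ : ℝ, 0 < U₀ ∧
    ∀ U ∈ Set.Ioc (0 : ℝ) U₀, ∀ g ∈ Set.Ioc (0 : ℝ) (1 / 10), ∀ β : ℝ, 1 ≤ β → ∃ μ₀ ∈ Set.Icc μ₁ μ₂,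
      ∃ p : ℝ → ℝ, ∃ r : ℝ, 0 < r ∧
        (∀ μ ∈ Set.Icc (μ₀ - r) (μ₀ + r),
          Tendsto (fun L : ℕ => pG (L + 1) β U μ g) atTop (𝓝 (p μ))) ∧
        HasDerivAt p (1 - δ) μ₀

/-- Thermal line: exposed density at β ⇒ exponential tilting confines the block-diagonal number law
of the seeded Gibbs state to `|N − (1−δ)L²| ≤ ηL²` using pressure VALUES only ⇒ max-term sector
`N°` ⇒ one jump to `N_L` ⇒ `−log P_μ(N_L) ≤ η(βc₁ + log(2e/η))L² + o(L²)` ⇒ crux with the free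
entropy slack `log 4 − 2H((1−δ)/2) ≥ 0.0098`. -/
theorem crux_of_exposedDensityThermal :
    EvenSectorRealisesMin → OneJumpCost → ExposedDensityThermal → TwSeededEnsembleEquivalence := by
  sorry

/-! ## Card `source-as-regulator` -/

/-- **Optimiser floor, abstract form** (provable now): for a convex even `φ` with `φ 0`-normalised
increments, a controlled GAIN `φ h₁ − φ h_U > h₁²/g` between the regulator scale `h_U` and some
`h₁ ≥ h_U` forces every maximiser of `h ↦ φ h − h²/g` out of `[−h_U, h_U]`. -/
theorem optimizer_floor (φ : ℝ → ℝ) (g hU h₁ : ℝ) (hconv : ConvexOn ℝ Set.univ φ)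
    (heven : ∀ h, φ (-h) = φ h) (hg : 0 < g) (hUpos : 0 < hU) (h1 : hU ≤ h₁)
    (hgain : h₁ ^ 2 / g < φ h₁ - φ hU) :
    ∀ h : ℝ, |h| ≤ hU → φ h - h ^ 2 / g < φ h₁ - h₁ ^ 2 / g := by
  intro h hh
  have hle : φ h ≤ φ hU := by
    -- h = a • (-hU) + b • hU with a = (hU - h)/(2hU), b = (hU + h)/(2hU)
    have habs := abs_le.1 hh
    set a : ℝ := (hU - h) / (2 * hU) with ha
    set b : ℝ := (hU + h) / (2 * hU) with hb
    have h2 : 0 < 2 * hU := by linarith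
    have ha0 : 0 ≤ a := div_nonneg (by linarith [habs.2]) h2.le
    have hb0 : 0 ≤ b := div_nonneg (by linarith [habs.1]) h2.le
    have hab : a + b = 1 := by
      rw [ha, hb, ← add_div]
      field_simp
      ring
    have hcomb : a • (-hU) + b • hU = h := by
      simp only [smul_eq_mul, ha, hb]
      field_simp
      ring
    have := hconv.2 (Set.mem_univ (-hU)) (Set.mem_univ hU) ha0 hb0 hab
    rw [hcomb, heven hU, smul_eq_mul, smul_eq_mul] at this
    calc φ h ≤ a * φ hU + b * φ hU := this
      _ = φ hU := by rw [← add_mul, hab, one_mul]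
  have hsq : 0 ≤ h ^ 2 / g := div_nonneg (sq_nonneg _) hg.le
  linarith

/-- **T = 0 approximating-Hamiltonian theorem** for the seeded torus (β → ∞ companion of the
route's support item `TwApproximatingHamiltonian`; Bogoliubov Jr. minimax for an attractive
separable interaction): easy half = operator inequality `−(g/L²)ΔᴴΔ ≤ −h(Δ+Δᴴ) + h²L²/g`, hard half
= `E₀(Hgc) ≥ L² inf_h [ẽ_L(μ,h) + h²/g] − o(L²)`. -/
def TZeroAHM : Prop :=
  ∀ (U μ g : ℝ), 0 < g →
    (∀ (L : ℕ) [NeZero L] (h : ℝ),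
      (Hgc L U μ g).groundEnergy ≤ (dWaveSourceTorus L U μ h).groundEnergy + h ^ 2 * (L : ℝ) ^ 2 / g) ∧
    (∀ ε : ℝ, 0 < ε → ∃ L₀ : ℕ, ∀ (L : ℕ) [NeZero L], L₀ ≤ L → ∃ h : ℝ,
      (dWaveSourceTorus L U μ h).groundEnergy + h ^ 2 * (L : ℝ) ^ 2 / g ≤
        (Hgc L U μ g).groundEnergy + ε * (L : ℝ) ^ 2)

/-- **C⁺ of the card: SOURCED NODAL REGULARITY — the pair source as infrared regulator.**
For sources ABOVE the Cooper scale, `e^{−a/U} ≤ h' ≤ h ≤ h₀`, and for EVERY `β ≥ 1` (no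
temperature floor): (i) two-sided Cooper-log INCREMENT bounds of the sourced torus pressure
(they contain `TwSourcedInertness`/`TwSourcedCondensation` at `β ≤ e^{a/U}` and extend them below
`T = e^{−a/U}` for regulated sources); (ii) the T = 0 sourced ground-energy density
`ẽ(μ,h) = lim L⁻² E₀(dWaveSourceTorus_L)` exists on window × `[e^{−a/U}, h₀]`, is `C¹` in `μ` with a
density `n(μ,h)` jointly continuous, and `s ↦ ẽ(μ,√s)` is strictly convex there (unique modulus).
Technique class: multiscale fermionic RG with the Nambu source as IR cutoff above scale `h`
(BGM 2006 arithmetic `|U| log(1/h) ≤ a`) and anisotropic-Dirac nodal RG below it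
(Giuliani–Mastropietro 2010 class). -/
def SourcedNodalRegularity : Prop :=
  ∀ μ₁ μ₂ : ℝ, -4 < μ₁ → μ₁ ≤ μ₂ → μ₂ < 0 →
    ∃ U₀ a c C h₀ : ℝ, 0 < U₀ ∧ 0 < a ∧ 0 < c ∧ c ≤ C ∧ 0 < h₀ ∧
    ∀ U : ℝ, 0 < U → U ≤ U₀ → Real.exp (-a / U) < h₀ ∧
      -- (i) regulated Cooper-log increments, all β ≥ 1
      (∀ β : ℝ, 1 ≤ β → ∀ μ ∈ Set.Icc μ₁ μ₂, ∃ L₀ : ℕ, ∀ (L : ℕ) [NeZero L], L₀ ≤ L →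
        ∀ h h' : ℝ, Real.exp (-a / U) ≤ h' → h' ≤ h → h ≤ h₀ →
          c * (h ^ 2 - h' ^ 2) * Real.log (1 / (h + 1 / β)) - C * (h ^ 2 - h' ^ 2) ≤
              pS L β U μ h - pS L β U μ h' ∧
          pS L β U μ h - pS L β U μ h' ≤ C * (h ^ 2 - h' ^ 2) * (1 + Real.log (1 / (h' + 1 / β)))) ∧
      -- (ii) T = 0 sourced energy density: limit, C¹ in μ, strictly convex in s = h² on the floor
      (∃ et nd : ℝ → ℝ → ℝ,
        (∀ μ ∈ Set.Icc μ₁ μ₂, ∀ h ∈ Set.Icc (Real.exp (-a / U)) h₀,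
          Tendsto (fun L : ℕ => (dWaveSourceTorus (L + 1) U μ h).groundEnergy / ((L + 1 : ℕ) : ℝ) ^ 2)
            atTop (𝓝 (et μ h)) ∧
          HasDerivAt (fun μ' => et μ' h) (-(nd μ h)) μ) ∧
        ContinuousOn (fun q : ℝ × ℝ => nd q.1 q.2) (Set.Icc μ₁ μ₂ ×ˢ Set.Icc (Real.exp (-a / U)) h₀) ∧
        (∀ μ ∈ Set.Icc μ₁ μ₂,
          StrictConvexOn ℝ (Set.Icc (Real.exp (-a / U) ^ 2) (h₀ ^ 2)) (fun s => et μ (Real.sqrt s))))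

/-- **Seeded optimiser floor** (consequence of (i) + convexity/evenness of `h ↦ pS` + the abstract
lemma, for seeds `g ≥ K U` and temperatures below the Cooper ceiling): every near-maximiser of the
Bogoliubov payoff `h ↦ p̃_L(h) − h²/g` has modulus `≥ e^{−a/U}` — so only REGULATED sources are
ever consulted by the approximating-Hamiltonian theorem on the route's seeds. -/
def SeededOptimizerFloor : Prop :=
  ∀ μ₁ μ₂ : ℝ, -4 < μ₁ → μ₁ ≤ μ₂ → μ₂ < 0 → ∃ U₀ a K h₀ : ℝ, 0 < U₀ ∧ 0 < a ∧ 0 < K ∧ 0 < h₀ ∧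
    ∀ U : ℝ, 0 < U → U ≤ U₀ → K * U ≤ 1 / 10 ∧ ∀ g ∈ Set.Icc (K * U) (1 / 10),
      ∀ β : ℝ, Real.exp (a / U) ≤ β → ∀ μ ∈ Set.Icc μ₁ μ₂,
        ∃ θ : ℝ, 0 < θ ∧ ∃ L₀ : ℕ, ∀ (L : ℕ) [NeZero L], L₀ ≤ L → ∀ h : ℝ, |h| < Real.exp (-a / U) →
          ∃ h₁ ∈ Set.Icc (Real.exp (-a / U)) h₀,
            pS L β U μ h - h ^ 2 / g + θ ≤ pS L β U μ h₁ - h₁ ^ 2 / g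

/-- Convexity and evenness of the sourced torus pressure in the source (finite `L`; convexity of
`h ↦ log Tr e^{−β(K − hQ)}`, evenness by the gauge rotation `c ↦ i c`). Provable now / partly in
tree (`partitionFn_dWaveSourceTorus_neg` in the `TwSourcedCondensation` disproof file). -/
def SourcedPressureConvexEven : Prop :=
  ∀ (L : ℕ) [NeZero L] (β U μ : ℝ), 0 < β →
    ConvexOn ℝ Set.univ (fun h => pS L β U μ h) ∧ ∀ h : ℝ, pS L β U μ (-h) = pS L β U μ h

theorem seededOptimizerFloor_of_nodal :
    SourcedPressureConvexEven → SourcedNodalRegularity → SeededOptimizerFloor := by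
  sorry

/-- `ExposedDensityT0` restricted to the route's seeds `g ∈ [K U, 1/10]` (the floor regime). -/
def ExposedDensityOnFloorSeeds : Prop :=
  ∀ δ ∈ Set.Icc (1/10 : ℝ) (2/5 : ℝ), ∃ μ₁ μ₂ : ℝ, -4 < μ₁ ∧ μ₁ ≤ μ₂ ∧ μ₂ < 0 ∧ ∃ U₀ K : ℝ,
    0 < U₀ ∧ 0 < K ∧ K * U₀ ≤ 1 / 10 ∧
    ∀ U ∈ Set.Ioc (0 : ℝ) U₀, ∀ g ∈ Set.Icc (K * U) (1 / 10), ∃ μ₀ ∈ Set.Icc μ₁ μ₂,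
      ∃ e : ℝ → ℝ, ∃ r : ℝ, 0 < r ∧
        (∀ μ ∈ Set.Icc (μ₀ - r) (μ₀ + r),
          Tendsto (fun L : ℕ => (Hgc (L + 1) U μ g).groundEnergy / ((L + 1 : ℕ) : ℝ) ^ 2)
            atTop (𝓝 (e μ))) ∧
        HasDerivAt e (-(1 - δ)) μ₀

/-- **Floor branch of the dichotomy**: T = 0 AHM + nodal regularity + optimiser floor ⇒ the seeded
grand-canonical ground-energy density is `inf` over REGULATED sources of a `C¹`, uniquely-minimised
family ⇒ differentiable in `μ` (Danskin) with a continuous strictly increasing density sweeping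
`[0.6, 0.9]` ⇒ exposed density at `1−δ`, for every route seed and with NO temperature in sight. -/
theorem exposedDensity_of_nodal :
    TZeroAHM → SourcedPressureConvexEven → SourcedNodalRegularity → SeededOptimizerFloor →
      ExposedDensityOnFloorSeeds := by
  sorry

/-- **Seed monotonicity** (provable now): the seed is `−(g/L²)·(PSD)`, so sector ground energies
are non-increasing in `g` ... -/
theorem seedMonotone_minEnergyOn (L : ℕ) [NeZero L] (U g₀ g : ℝ) (hg : g₀ ≤ g)
    (K : Submodule ℂ (Fock (Orb (FermionTorus 2 L)))) (hK : K ≠ ⊥) :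
    (Hcan L U g).minEnergyOn K ≤ (Hcan L U g₀).minEnergyOn K := by
  sorry

/-- ... hence the **transfer inequality** `A_L(g) ≤ A_L(g₀) + [p_L(g) − p_L(g₀)]` for `g₀ ≤ g`:
the crux at seed `g` is the crux at any smaller seed plus the grand-canonical seed response of the
pressure (pure-model domination for `g₀ = 0`). Provable now. -/
theorem transfer_ineq (L : ℕ) [NeZero L] (δ β U μ g₀ g : ℝ) (hg : g₀ ≤ g) :
    cruxLHS L δ β U μ g ≤ cruxLHS L δ β U μ g₀ + (pG L β U μ g - pG L β U μ g₀) := by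
  sorry

/-- **The inert plateau** — the part of the crux that follows NOW from three route items
(`TwPureThermalBound`, the hard half of `TwApproximatingHamiltonian`, `TwSourcedInertness`):
for `β ≤ e^{a/U}` and seeds with `C(1 + log β) g ≤ 1` the grand-canonical seed response vanishes
in the limit, and `transfer_ineq` with `g₀ = 0` hands the crux over to the pure model. -/
def CruxOnInertPlateau : Prop :=
  ∀ δ ∈ Set.Icc (1/10 : ℝ) (2/5 : ℝ), ∃ μ₁ μ₂ : ℝ, -4 < μ₁ ∧ μ₁ ≤ μ₂ ∧ μ₂ < 0 ∧ ∃ U₀ : ℝ, 0 < U₀ ∧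
    ∀ U ∈ Set.Ioc (0 : ℝ) U₀, ∃ a C : ℝ, 0 < a ∧ 0 < C ∧
      ∀ β : ℝ, 1 ≤ β → β ≤ Real.exp (a / U) → ∀ g ∈ Set.Ioc (0 : ℝ) (1 / 10),
        C * (1 + Real.log β) * g ≤ 1 →
          ∃ μ ∈ Set.Icc μ₁ μ₂, ∀ ε : ℝ, 0 < ε → ∃ L₀ : ℕ, ∀ (L : ℕ) [NeZero L], L₀ ≤ L →
            cruxLHS L δ β U μ g ≤ Real.log 4 / β + ε

theorem cruxOnInertPlateau_of_route_items :
    TwPureThermalBound → TwApproximatingHamiltonian → TwSourcedInertness → CruxOnInertPlateau := by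
  sorry

/-- **Sub-floor domination band** (the other branch of the dichotomy, below the Cooper ceiling):
if the AHM optimiser at `(β, μ, g)` lies BELOW the regulator `h_U = e^{−a/U}`, convexity in `h`
caps the grand-canonical condensation pressure by `g · D_L(β,μ,h_U)²` with `D = ∂_{2h} p̃` the
(regulated, hence controlled) pair amplitude at the floor; `transfer_ineq` + the entropy slack
`log 4 − 2H((1−δ)/2) > 0` then give the crux whenever `g D² ≤ slack/β` — squaring the reachable
ceiling temperature for sub-floor seeds. Stated as the dichotomy output: the seeded pressure is
below the better of (regulated payoff bound `M`, unseeded pressure + `g D(h_U)²`). -/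
def SubfloorDomination : Prop :=
  ∀ μ₁ μ₂ : ℝ, -4 < μ₁ → μ₁ ≤ μ₂ → μ₂ < 0 → ∃ U₀ a C : ℝ, 0 < U₀ ∧ 0 < a ∧ 0 < C ∧
    ∀ U : ℝ, 0 < U → U ≤ U₀ → ∀ g ∈ Set.Ioc (0 : ℝ) (1 / 10), ∀ β : ℝ, Real.exp (a / U) ≤ β →
      ∀ μ ∈ Set.Icc μ₁ μ₂, ∀ ε : ℝ, 0 < ε → ∃ L₀ : ℕ, ∀ (L : ℕ) [NeZero L], L₀ ≤ L → ∀ M : ℝ,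
        (∀ h : ℝ, Real.exp (-a / U) ≤ |h| → pS L β U μ h - h ^ 2 / g ≤ M) →
          pG L β U μ g ≤ max M (pS L β U μ 0 + g * (C * (a / U) * Real.exp (-a / U)) ^ 2) + ε

end Summit.HubbardSuperconductivity.HubbardSuperconductivity.Cruxes.TwSeededEnsembleEquivalence.Ideator1
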